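import Summits.HubbardSuperconductivity.HubbardSuperconductivity.Theorems.AnisotropyChordTowerTransposition

/-!
# Route `AnisotropyChord` / H0 rotor rung: THE TRANSPOSITION FORM (II): subset-sum formula for the tower, degree count, Ising bond sum, COUNTING IDENTITY
(port of theory seat `hubbard-h0-rotor-theory-1`, cycle 11, Sketch11 Part H; work-order v12b; director CYCLE-12 ruling (A); linters
`unusedSectionVars`/`unusedVariables` disabled as in the theory seat's file).  Typing/proof authority: theory seat.  Part H summary:

## Part H — THE TRANSPOSITION FORM OF `H_FM − e₀`, PERMUTATION EQUIVARIANCE OF THE TOWER, THE SUBSET-SUM FORMULA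
AND THE COUNTING IDENTITY ON REGULAR GRAPHS (memo §156 (L1)+(L3), §157(b); port spec P-12 item v12b)

`A := fmOp G` is `H_FM − e₀ = ½ Σ_{edges} (1 − T_xy)` acting on amplitudes by edge transpositions: a sum of squares
(`inner_fmOp_eq`, hence `⪰ 0`), killing every function of the particle number (`fmOp_sectorFun`), with
`⟨b, A b⟩ = 0 ⇒ b` edge-transposition invariant (`swapInvariant_of_inner_fmOp_eq_zero`; on a connected graph this is
"constant on sectors" — the connectivity step is left to the port), and commuting with `S⁺_tot` (`raiseSum_fmOp`).
`raiseIter_eq_subsetSum` writes the tower `(S⁺)^k f` as `k!`× a sum over sub-configurations; with the degree count and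
`isingW_eq` it gives the COUNTING IDENTITY `raiseIter_edgeMinusMean` (= the one-magnon closure `W φ₀ = w₀ φ₀ + (S⁺)^{n−2} u /((n−2)! N_n)`)
and `lowerSum_edgeMinusMean` (regular ⇒ `u` is a lowest-weight two-magnon vector), i.e. the inputs (L1), (L3) of THEOREM P′.
-/

set_option linter.dupNamespace false
set_option linter.unusedSectionVars false
set_option linter.unusedVariables false
set_option autoImplicit false

noncomputable section

open Finset Filter Topology
open Summit.HubbardSuperconductivity.HubbardSuperconductivity.Theorems.AnisotropyChord.InsertionEntropy
open Literature.MathematicalPhysics.QuantumLattice Literature.Probability.LatticeModels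

namespace Summit.HubbardSuperconductivity.HubbardSuperconductivity.Theorems.AnisotropyChord.Tower

section Transposition

variable {V : Type} [Fintype V] [DecidableEq V]

variable (G : SimpleGraph V) [DecidableRel G.Adj]

/-! ### H.3 the raising tower as a SUBSET SUM: `(S⁺)^k f (σ) = k! Σ_{T ⊆ Z(σ), |T| = m} f(T)` -/

/-- the particle (zero) set of a configuration and the configuration of a particle set. -/
def zeroSet (σ : V → Fin 2) : Finset V := univ.filter fun x => σ x = 0
/-- The configuration with occupied set `T`. [folklore] -/
def cfgOf (T : Finset V) : V → Fin 2 := fun x => if x ∈ T then 0 else 1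

/-- `zerosCard σ = #zeroSet σ`. [folklore] -/
theorem zerosCard_eq_card (σ : V → Fin 2) : zerosCard σ = ((zeroSet σ).card : ℝ) := rfl

/-- Membership in the occupied set. [folklore] -/
theorem mem_zeroSet {σ : V → Fin 2} {x : V} : x ∈ zeroSet σ ↔ σ x = 0 := by simp [zeroSet]

/-- Every element of `Fin 2` is `0` or `1`. [folklore] -/
private theorem fin2_cases' (i : Fin 2) : i = 0 ∨ i = 1 := by
  rcases i with ⟨_ | _ | k, hk⟩
  · left; rfl
  · right; rfl
  · omega

/-- `zeroSet (cfgOf T) = T`. [folklore] -/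
theorem zeroSet_cfgOf (T : Finset V) : zeroSet (cfgOf T) = T := by
  ext x; simp only [zeroSet, cfgOf, Finset.mem_filter, Finset.mem_univ, true_and]
  by_cases h : x ∈ T <;> simp [h]

/-- `cfgOf (zeroSet σ) = σ`. [folklore] -/
theorem cfgOf_zeroSet (σ : V → Fin 2) : cfgOf (zeroSet σ) = σ := by
  funext x; unfold cfgOf
  by_cases h : σ x = 0
  · simp [mem_zeroSet, h]
  · have h1 : σ x = 1 := (fin2_cases' (σ x)).resolve_left h
    simp [mem_zeroSet, h1]

/-- Removing a particle erases it from the occupied set. [folklore] -/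
theorem zeroSet_update_one (σ : V → Fin 2) (x : V) :
    zeroSet (Function.update σ x 1) = (zeroSet σ).erase x := by
  ext z
  simp only [zeroSet, Finset.mem_filter, Finset.mem_univ, true_and, Finset.mem_erase]
  by_cases hz : z = x
  · subst hz; simp
  · rw [Function.update_of_ne hz]; simp [hz]

/-- the combinatorial swap `Σ_{x∈Z} Σ_{T ⊆ Z∖x, |T|=m} g T = (|Z| − m) Σ_{T ⊆ Z, |T| = m} g T`. -/
theorem sum_erase_powersetCard (Z : Finset V) (m : ℕ) (hm : m ≤ Z.card) (g : Finset V → ℝ) :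
    ∑ x ∈ Z, ∑ T ∈ (Z.erase x).powersetCard m, g T
      = (((Z.card : ℕ) : ℝ) - m) * ∑ T ∈ Z.powersetCard m, g T := by
  have hfilter : ∀ x ∈ Z, (Z.erase x).powersetCard m = (Z.powersetCard m).filter (fun T => x ∉ T) := by
    intro x _; ext T
    simp only [Finset.mem_powersetCard, Finset.mem_filter, Finset.subset_erase]
    tauto
  rw [Finset.sum_congr rfl (fun x hx => by rw [hfilter x hx, Finset.sum_filter])]
  rw [Finset.sum_comm, Finset.mul_sum]
  refine Finset.sum_congr rfl fun T hT => ?_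
  rw [Finset.mem_powersetCard] at hT
  rw [← Finset.sum_filter, Finset.sum_const, nsmul_eq_mul]
  have hsd : (Z.filter (fun x => x ∉ T)) = Z \ T := by ext z; simp [Finset.mem_sdiff]
  rw [hsd]
  have hc := Finset.card_sdiff_add_card_eq_card hT.1
  have : ((Z \ T).card : ℝ) = (Z.card : ℝ) - m := by
    rw [← hT.2]; have := congrArg (fun n : ℕ => (n : ℝ)) hc; push_cast at this; linarith
  rw [this]

/-- **SUBSET-SUM FORMULA**: for `f` supported on the `m`-particle sector and `σ` with `m + k` particles,
`((S⁺)^k f)(σ) = k! · Σ_{T ⊆ Z(σ), |T| = m} f(cfgOf T)`. [folklore] -/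
theorem raiseIter_eq_subsetSum (f : (V → Fin 2) → ℝ) (m : ℕ)
    (hsupp : ∀ ν, f ν ≠ 0 → zerosCard ν = m) :
    ∀ (k : ℕ) (σ : V → Fin 2), zerosCard σ = (m : ℝ) + k →
      raiseIter k f σ = (k.factorial : ℝ) * ∑ T ∈ (zeroSet σ).powersetCard m, f (cfgOf T) := by
  intro k
  induction k with
  | zero =>
      intro σ hσ
      have hcard : (zeroSet σ).card = m := by
        rw [zerosCard_eq_card] at hσ; exact_mod_cast (by simpa using hσ)
      simp only [raiseIter, Nat.factorial_zero, Nat.cast_one, one_mul]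
      rw [← hcard, Finset.powersetCard_self, Finset.sum_singleton, cfgOf_zeroSet]
  | succ k ih =>
      intro σ hσ
      show raiseSum (raiseIter k f) σ = _
      unfold raiseSum
      rw [← Finset.sum_filter]
      change ∑ x ∈ zeroSet σ, raiseIter k f (Function.update σ x 1) = _
      have hk : ∀ x ∈ zeroSet σ, raiseIter k f (Function.update σ x 1)
          = (k.factorial : ℝ) * ∑ T ∈ ((zeroSet σ).erase x).powersetCard m, f (cfgOf T) := by
        intro x hx
        have hx0 : σ x = 0 := mem_zeroSet.mp hx
        have hz : zerosCard (Function.update σ x 1) = (m : ℝ) + k := by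
          have := zerosCard_update_one hx0; rw [hσ] at this; push_cast at this ⊢; linarith
        rw [ih _ hz, zeroSet_update_one]
      rw [Finset.sum_congr rfl hk, ← Finset.mul_sum]
      have hcardR : ((zeroSet σ).card : ℝ) = (m : ℝ) + (k + 1) := by
        rw [zerosCard_eq_card] at hσ; push_cast at hσ; linarith
      have hm : m ≤ (zeroSet σ).card := by
        have : (m : ℝ) ≤ (zeroSet σ).card := by rw [hcardR]; linarith
        exact_mod_cast this
      rw [sum_erase_powersetCard (zeroSet σ) m hm, hcardR, Nat.factorial_succ]
      push_cast; ring

/-! ### H.4 the COUNTING IDENTITY on a regular graph (the one-magnon closure, memo §156 (L1)+(L3)) -/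

/-- ordered intra-particle adjacent pairs and ordered broken pairs `(particle, hole)`, as reals. -/
noncomputable def insideOrd (σ : V → Fin 2) : ℝ :=
  ∑ x, ∑ y, if G.Adj x y ∧ σ x = 0 ∧ σ y = 0 then (1:ℝ) else 0
/-- Ordered count of broken (particle–hole) edges of a configuration. [folklore] -/
noncomputable def brokenOrd (σ : V → Fin 2) : ℝ :=
  ∑ x, ∑ y, if G.Adj x y ∧ σ x = 0 ∧ σ y = 1 then (1:ℝ) else 0

/-- the Ising bond sum `W(σ) = Σ_{edges} s_x s_y` (`s = ±½`), with ordered pairs. -/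
noncomputable def isingW (σ : V → Fin 2) : ℝ :=
  (1/2 : ℝ) * ∑ x, ∑ y, if G.Adj x y then (if σ x = σ y then (1/4 : ℝ) else -(1/4 : ℝ)) else 0

/-- **degree count**: on a `d`-regular graph, `d · n(σ) = insideOrd σ + brokenOrd σ`. -/
theorem degree_count (d : ℕ) (hreg : ∀ x : V, (∑ y, if G.Adj x y then (1:ℝ) else 0) = d)
    (σ : V → Fin 2) : (d : ℝ) * zerosCard σ = insideOrd G σ + brokenOrd G σ := by
  unfold insideOrd brokenOrd zerosCard
  rw [Finset.card_filter]; push_cast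
  rw [Finset.mul_sum, ← Finset.sum_add_distrib]
  refine Finset.sum_congr rfl fun x _ => ?_
  rw [← Finset.sum_add_distrib]
  by_cases hx : σ x = 0
  · simp only [hx, if_true, mul_one, true_and]
    rw [← hreg x]
    refine Finset.sum_congr rfl fun y _ => ?_
    rcases fin2_cases' (σ y) with hy | hy <;> simp [hy]
  · simp [hx]

/-- ordered broken pairs `(hole, particle)`; equals `brokenOrd` by the symmetry of adjacency. -/
noncomputable def brokenOrd' (σ : V → Fin 2) : ℝ :=
  ∑ x, ∑ y, if G.Adj x y ∧ σ x = 1 ∧ σ y = 0 then (1:ℝ) else 0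

/-- The two ordered broken-edge counts agree. [folklore] -/
theorem brokenOrd'_eq (σ : V → Fin 2) : brokenOrd' G σ = brokenOrd G σ := by
  unfold brokenOrd brokenOrd'
  rw [Finset.sum_comm]
  refine Finset.sum_congr rfl fun x _ => Finset.sum_congr rfl fun y _ => ?_
  have hc : G.Adj y x ↔ G.Adj x y := G.adj_comm y x
  by_cases h : G.Adj x y
  · have h' : G.Adj y x := hc.mpr h
    simp only [h, h', true_and]
    by_cases a : σ y = 1 <;> by_cases c : σ x = 0 <;> simp [a, c]
  · have h' : ¬ G.Adj y x := fun q => h (hc.mp q)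
    simp [h, h']

/-- Scalar through a double sum. [folklore] -/
private theorem smul_sum₂ (c : ℝ) (F : V → V → ℝ) : c * ∑ x, ∑ y, F x y = ∑ x, ∑ y, c * F x y := by
  rw [Finset.mul_sum]; exact Finset.sum_congr rfl fun x _ => by rw [Finset.mul_sum]

/-- Difference of double sums. [folklore] -/
private theorem sum₂_sub (F F' : V → V → ℝ) :
    (∑ x, ∑ y, F x y) - (∑ x, ∑ y, F' x y) = ∑ x, ∑ y, (F x y - F' x y) := by
  rw [← Finset.sum_sub_distrib]; exact Finset.sum_congr rfl fun x _ => by rw [Finset.sum_sub_distrib]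

/-- Sum of double sums. [folklore] -/
private theorem sum₂_add (F F' : V → V → ℝ) :
    (∑ x, ∑ y, F x y) + (∑ x, ∑ y, F' x y) = ∑ x, ∑ y, (F x y + F' x y) := by
  rw [← Finset.sum_add_distrib]; exact Finset.sum_congr rfl fun x _ => by rw [Finset.sum_add_distrib]

/-- **Ising eigenvalue via broken bonds**: `W(σ) = (Σ_x d_x)/8 − ¼ (brokenOrd + brokenOrd') = (Σ_x d_x)/8 − ½ brokenOrd`. -/
theorem isingW_eq (σ : V → Fin 2) :
    isingW G σ = (1/8 : ℝ) * (∑ x, ∑ y, if G.Adj x y then (1:ℝ) else 0) - (1/2 : ℝ) * brokenOrd G σ := by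
  have hhalf : (1/2 : ℝ) * brokenOrd G σ = (1/4 : ℝ) * brokenOrd G σ + (1/4 : ℝ) * brokenOrd' G σ := by
    rw [brokenOrd'_eq]; ring
  rw [hhalf]
  unfold isingW brokenOrd brokenOrd'
  rw [smul_sum₂, smul_sum₂, smul_sum₂, smul_sum₂, sum₂_add, sum₂_sub]
  refine Finset.sum_congr rfl fun x _ => Finset.sum_congr rfl fun y _ => ?_
  by_cases h : G.Adj x y
  · rcases fin2_cases' (σ x) with hx | hx <;> rcases fin2_cases' (σ y) with hy | hy <;>
      simp [h, hx, hy] <;> norm_num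
  · simp [h]

/-- the two-particle "edge minus mean" amplitude `u(τ) = [n(τ) = 2]·(½ insideOrd τ − κ)` (`κ = |E|/C(V,2)`):
the highest-weight two-magnon vector of memo §156 (L3). -/
noncomputable def edgeMinusMean (κ : ℝ) (τ : V → Fin 2) : ℝ :=
  if zerosCard τ = 2 then ((1/2 : ℝ) * insideOrd G τ - κ) else 0

/-- pairs inside a set, counted through its 2-subsets: `Σ_{T ⊆ Z, |T| = 2} insideOrd(cfgOf T) = insideOrd` restricted to `Z`. -/
theorem sum_powersetCard_two_insideOrd (Z : Finset V) :
    ∑ T ∈ Z.powersetCard 2, insideOrd G (cfgOf T)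
      = ∑ x ∈ Z, ∑ y ∈ Z, if G.Adj x y then (1:ℝ) else 0 := by
  -- each 2-subset {x,y} contributes [x∼y] + [y∼x]
  have hT : ∀ T ∈ Z.powersetCard 2, insideOrd G (cfgOf T)
      = ∑ x ∈ Z, ∑ y ∈ Z, if G.Adj x y ∧ x ∈ T ∧ y ∈ T then (1:ℝ) else 0 := by
    intro T hT
    rw [Finset.mem_powersetCard] at hT
    unfold insideOrd
    rw [← Finset.sum_subset (Finset.subset_univ Z)]
    · refine Finset.sum_congr rfl fun x _ => ?_
      rw [← Finset.sum_subset (Finset.subset_univ Z)]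
      · refine Finset.sum_congr rfl fun y _ => ?_
        simp only [cfgOf]
        by_cases hx : x ∈ T <;> by_cases hy : y ∈ T <;> simp [hx, hy]
      · intro y _ hy
        have : y ∉ T := fun h => hy (hT.1 h)
        simp [cfgOf, this]
    · intro x _ hx
      have : x ∉ T := fun h => hx (hT.1 h)
      apply Finset.sum_eq_zero; intro y _; simp [cfgOf, this]
  rw [Finset.sum_congr rfl hT, Finset.sum_comm]
  refine Finset.sum_congr rfl fun x hx => ?_
  rw [Finset.sum_comm]
  refine Finset.sum_congr rfl fun y hy => ?_
  by_cases hxy : G.Adj x y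
  · have hne : x ≠ y := G.ne_of_adj hxy
    simp only [hxy, true_and, if_true]
    rw [← Finset.sum_filter]
    have hone : ((Z.powersetCard 2).filter (fun T => x ∈ T ∧ y ∈ T)) = {({x, y} : Finset V)} := by
      ext T
      simp only [Finset.mem_filter, Finset.mem_powersetCard, Finset.mem_singleton]
      constructor
      · rintro ⟨⟨hTZ, hc⟩, hxT, hyT⟩
        symm
        apply Finset.eq_of_subset_of_card_le
        · intro z hz; simp only [Finset.mem_insert, Finset.mem_singleton] at hz
          rcases hz with rfl | rfl <;> assumption
        · rw [hc, Finset.card_pair hne]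
      · rintro rfl
        refine ⟨⟨?_, Finset.card_pair hne⟩, by simp, by simp⟩
        intro z hz; simp only [Finset.mem_insert, Finset.mem_singleton] at hz
        rcases hz with rfl | rfl <;> assumption
    rw [hone, Finset.sum_singleton]
  · simp [hxy]

/-- **COUNTING IDENTITY** (memo §157(b)): for `σ` with `n ≥ 2` particles,
`((S⁺)^{n−2} u)(σ) = (n−2)! · (½ insideOrd σ − κ · C(n,2))`. -/
theorem raiseIter_edgeMinusMean (κ : ℝ) (n : ℕ) (hn : 2 ≤ n) (σ : V → Fin 2)
    (hσ : zerosCard σ = n) :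
    raiseIter (n - 2) (edgeMinusMean G κ) σ
      = ((n - 2).factorial : ℝ) * ((1/2 : ℝ) * insideOrd G σ - κ * (n.choose 2 : ℝ)) := by
  have hsupp : ∀ ν, edgeMinusMean G κ ν ≠ 0 → zerosCard ν = (2 : ℕ) := by
    intro ν hν; unfold edgeMinusMean at hν
    by_contra h
    exact hν (by rw [if_neg]; exact_mod_cast h)
  have hσ' : zerosCard σ = ((2 : ℕ) : ℝ) + ((n - 2 : ℕ) : ℝ) := by
    rw [hσ]; push_cast [Nat.cast_sub hn]; ring
  rw [raiseIter_eq_subsetSum _ 2 hsupp (n - 2) σ hσ']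
  congr 1
  have hval : ∀ T ∈ (zeroSet σ).powersetCard 2, edgeMinusMean G κ (cfgOf T)
      = (1/2 : ℝ) * insideOrd G (cfgOf T) - κ := by
    intro T hT
    rw [Finset.mem_powersetCard] at hT
    unfold edgeMinusMean
    rw [if_pos]
    rw [zerosCard_eq_card, zeroSet_cfgOf, hT.2]; norm_num
  rw [Finset.sum_congr rfl hval, Finset.sum_sub_distrib, ← Finset.mul_sum,
    sum_powersetCard_two_insideOrd, Finset.sum_const, Finset.card_powersetCard, nsmul_eq_mul]
  have hcard : (zeroSet σ).card = n := by
    rw [zerosCard_eq_card] at hσ; exact_mod_cast hσ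
  rw [hcard]
  -- insideOrd σ restricted to Z(σ) is insideOrd σ
  have hins : (∑ x ∈ zeroSet σ, ∑ y ∈ zeroSet σ, if G.Adj x y then (1:ℝ) else 0) = insideOrd G σ := by
    unfold insideOrd
    rw [← Finset.sum_subset (Finset.subset_univ (zeroSet σ))]
    · refine Finset.sum_congr rfl fun x hx => ?_
      rw [← Finset.sum_subset (Finset.subset_univ (zeroSet σ))]
      · refine Finset.sum_congr rfl fun y hy => ?_
        simp [mem_zeroSet.mp hx, mem_zeroSet.mp hy]
      · intro y _ hy
        have : ¬ σ y = 0 := fun h => hy (mem_zeroSet.mpr h)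
        simp [this]
    · intro x _ hx
      have : ¬ σ x = 0 := fun h => hx (mem_zeroSet.mpr h)
      apply Finset.sum_eq_zero; intro y _; simp [this]
  rw [hins]; ring

end Transposition

end Summit.HubbardSuperconductivity.HubbardSuperconductivity.Theorems.AnisotropyChord.Tower
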